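import Summits.NavierStokesRegularity.NavierStokesRegularity.Theorems.CircuitPump.Negative.LoadBearing
import Literature.Analysis.ODE.OneSidedComparison

/-!
# `PerpetualPump.CircuitPump` (stmt-NavierStokesRegularity-1834), line `singular-clock-gspt`:
# the rise (clock) lemma of the damped Toda transfer gate

Sub-goal `toda_rise_clock` of `stub_clockBox` (Toda `m = 2` instance). The gate block is
`u' = -u - v² + p`, `v' = v(u - w) - v + s`, `w' = -ν w + v² + r` on `[0,T]`, `T ≤ 1/2`,
`|p|, |r| ≤ P`, `0 ≤ s ≤ Ps`, `u(0) = A ≥ 400(1+P)`, `w(0) ∈ [0,1]`, `v(0) > 0`.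
While the bond is small (`v ≤ A/8` on `[0,t]`) everything is explicit (`toda_rise_clock`):
`u = A e^{-t} + O(v²/A + Pt)`, `w = O(1 + v²/A + Pt)`, and the clock reads
`log (v(t)/v(0)) = A(1 - e^{-t}) - t ± O(1)`.

Proof (pure real analysis, integral-free). A continuity argument on the closed condition
`D = u - w ≥ A/2 + 1` (`riseClock_boot`, first exit time `maximalTimeP`): while it holds, the bond
grows at rate `≥ A/2`, i.e. `2 v v' ≥ A v²`, so `v²/A` is a Lyapunov majorant of the drained
energy `∫ v²`; one-sided exponential barriers (`Literature.Analysis.ODE.OneSidedComparison`) for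
`u - A e^{-t} ∓ …` and `w ± …` give the carrier brackets (`riseClock_lin`, `riseClock_phase`),
which improve the condition to `D ≥ (4/7)A - A/32 - P - 1 > A/2 + 1`. The clock
(`riseClock_clock`): `(log v)' = D - 1 + s/v`; the lower bound is the monotonicity of
`log v - A(1 - e^{-τ}) + 2τ + Pτ² + 2v²/A²`, the upper bound is variation of constants:
`v e^{-Φ} + (2Ps/A) e^{-Aτ/2}` is non-increasing for `Φ(τ) = A(1 - e^{-τ}) - τ + Pτ² ≥ Aτ/2`.
[folklore]
-/

set_option linter.dupNamespace false

noncomputable section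

open Set

namespace Summit.NavierStokesRegularity.NavierStokesRegularity.Theorems.PerpetualPumpCircuitPump

open Literature.Analysis.ODE

/-- `4/7 ≤ e^{-τ}` for `0 ≤ τ ≤ 1/2` (from `e^{τ} ≤ 1 + τ + τ² ≤ 7/4`). [folklore] -/
theorem riseClock_exp_ge {τ : ℝ} (h0 : 0 ≤ τ) (h1 : τ ≤ 1 / 2) : 4 / 7 ≤ Real.exp (-τ) := by
  have hb := Real.abs_exp_sub_one_sub_id_le (x := τ) (by rw [abs_of_nonneg h0]; linarith)
  have hle : Real.exp τ ≤ 7 / 4 := by nlinarith [(abs_le.mp hb).2]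
  have hmul : Real.exp (-τ) * Real.exp τ = 1 := by
    rw [← Real.exp_add, neg_add_cancel, Real.exp_zero]
  nlinarith [Real.exp_pos (-τ), mul_le_mul_of_nonneg_left hle (Real.exp_pos (-τ)).le]

/-- `e^{-τ} ≤ 1 - τ + τ²/2` for `τ ≥ 0` (from `1 + τ + τ²/2 ≤ e^{τ}`). [folklore] -/
theorem riseClock_exp_le {τ : ℝ} (h0 : 0 ≤ τ) : Real.exp (-τ) ≤ 1 - τ + τ ^ 2 / 2 := by
  have hq := Real.quadratic_le_exp_of_nonneg h0
  have hmul : Real.exp (-τ) * Real.exp τ = 1 := by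
    rw [← Real.exp_add, neg_add_cancel, Real.exp_zero]
  nlinarith [Real.exp_pos (-τ), mul_le_mul_of_nonneg_left hq (Real.exp_pos (-τ)).le,
    sq_nonneg (τ ^ 2), sq_nonneg τ, (by positivity : (0 : ℝ) < 1 + τ + τ ^ 2 / 2)]

/-- Global one-sided linear facts on `[0,T]` (no bootstrap needed): the bond stays positive
(`v' = (D - 1)v + s ≥ (D - 1)v`, variable-coefficient comparison), the old carrier is below its
forced free decay (`(u - Ae^{-t} - Pt)' ≤ -(u - Ae^{-t} - Pt)`), and the new carrier is above
`-Pt` (`(w + Pt)' ≥ -ν (w + Pt)`). [folklore] -/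
theorem riseClock_lin {ν P T A : ℝ} {u v w p r s : ℝ → ℝ} (hν : 1 ≤ ν) (hP : 0 ≤ P)
    (hu0 : u 0 = A) (hw0 : 0 ≤ w 0) (hv0 : 0 < v 0)
    (hu : ContinuousOn u (Icc 0 T)) (hv : ContinuousOn v (Icc 0 T))
    (hw : ContinuousOn w (Icc 0 T))
    (hu' : ∀ t ∈ Ico 0 T, HasDerivWithinAt u (-u t - v t ^ 2 + p t) (Ici t) t)
    (hv' : ∀ t ∈ Ico 0 T, HasDerivWithinAt v (v t * (u t - w t) - v t + s t) (Ici t) t)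
    (hw' : ∀ t ∈ Ico 0 T, HasDerivWithinAt w (-ν * w t + v t ^ 2 + r t) (Ici t) t)
    (hp : ∀ t ∈ Icc 0 T, |p t| ≤ P) (hr : ∀ t ∈ Icc 0 T, |r t| ≤ P)
    (hs : ∀ t ∈ Icc 0 T, 0 ≤ s t) :
    ∀ t ∈ Icc 0 T, 0 < v t ∧ u t ≤ A * Real.exp (-t) + P * t ∧ -(P * t) ≤ w t := by
  intro t ht
  refine ⟨?_, ?_, ?_⟩
  · have h := linearComparison_le (A := fun _ => (0 : ℝ)) (β := fun x => u x - w x - 1) hv hv'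
      continuousOn_const ((hu.sub hw).sub continuousOn_const)
      (fun x hx => by linarith [hs x (Ico_subset_Icc_self hx)]) ht
    simp only [zero_mul, intervalIntegral.integral_zero, add_zero] at h
    exact (mul_pos (Real.exp_pos _) hv0).trans_le h
  · have hf' : ∀ x ∈ Ico 0 T, HasDerivWithinAt (fun y => u y - A * Real.exp (-y) - P * y)
        (-u x - v x ^ 2 + p x - A * (Real.exp (-x) * -1) - P * 1) (Ici x) x := fun x hx =>
      ((hu' x hx).fun_sub (((hasDerivAt_neg' x).exp.const_mul A).hasDerivWithinAt)).fun_sub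
        (((hasDerivAt_id' x).const_mul P).hasDerivWithinAt)
    have h := le_mul_exp_of_deriv_right_le (β := -1) (by fun_prop) hf'
      (fun x hx => by
        have := (abs_le.mp (hp x (Ico_subset_Icc_self hx))).2
        have := mul_nonneg hP hx.1
        nlinarith [sq_nonneg (v x)]) t ht
    simp only [hu0, neg_zero, Real.exp_zero, mul_one, mul_zero, sub_zero, sub_self,
      zero_mul] at h
    linarith
  · have hf' : ∀ x ∈ Ico 0 T, HasDerivWithinAt (fun y => w y + P * y)
        (-ν * w x + v x ^ 2 + r x + P * 1) (Ici x) x := fun x hx =>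
      (hw' x hx).fun_add (((hasDerivAt_id' x).const_mul P).hasDerivWithinAt)
    have h := exp_mul_le_of_le_deriv_right (β := -ν) (by fun_prop) hf'
      (fun x hx => by
        have := (abs_le.mp (hr x (Ico_subset_Icc_self hx))).1
        have := mul_nonneg (mul_nonneg (by linarith : (0 : ℝ) ≤ ν) hP) hx.1
        nlinarith [sq_nonneg (v x)]) t ht
    simp only [mul_zero, add_zero, sub_zero] at h
    nlinarith [mul_nonneg hw0 (Real.exp_pos (-ν * t)).le]

/-- Bootstrap-phase brackets. While `u - w ≥ A/2 + 1` on `[0,t₁)`, the bond grows at rate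
`≥ A/2` (`2 v v' ≥ A v²`), so `(v²/A)' ≥ v²` dominates the drained energy: the old carrier stays
above `A e^{-t} - v²/A - P t` (`(u - Ae^{-t} + v²/A + Pt)' ≥ -(u - Ae^{-t} + v²/A + Pt)`) and the
new carrier below `1 + v²/A + P t` (`(1 + v²/A + Pt - w)' ≥ -ν (1 + v²/A + Pt - w)`).
[folklore] -/
theorem riseClock_phase {ν P T A t₁ : ℝ} {u v w p r s : ℝ → ℝ} (hν : 1 ≤ ν) (hP : 0 ≤ P)
    (hA : 0 < A) (ht₁ : t₁ ≤ T) (hu0 : u 0 = A) (hw1 : w 0 ≤ 1)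
    (hu : ContinuousOn u (Icc 0 T)) (hv : ContinuousOn v (Icc 0 T))
    (hw : ContinuousOn w (Icc 0 T))
    (hu' : ∀ t ∈ Ico 0 T, HasDerivWithinAt u (-u t - v t ^ 2 + p t) (Ici t) t)
    (hv' : ∀ t ∈ Ico 0 T, HasDerivWithinAt v (v t * (u t - w t) - v t + s t) (Ici t) t)
    (hw' : ∀ t ∈ Ico 0 T, HasDerivWithinAt w (-ν * w t + v t ^ 2 + r t) (Ici t) t)
    (hp : ∀ t ∈ Icc 0 T, |p t| ≤ P) (hr : ∀ t ∈ Icc 0 T, |r t| ≤ P)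
    (hs : ∀ t ∈ Icc 0 T, 0 ≤ s t) (hvp : ∀ t ∈ Icc 0 T, 0 < v t)
    (hD : ∀ t ∈ Ico 0 t₁, A / 2 + 1 ≤ u t - w t) :
    ∀ t ∈ Icc 0 t₁, A * Real.exp (-t) - v t ^ 2 / A - P * t ≤ u t ∧
      w t ≤ 1 + v t ^ 2 / A + P * t := by
  intro t ht
  have hI : Icc 0 t₁ ⊆ Icc 0 T := Icc_subset_Icc_right ht₁
  have hI' : ∀ x ∈ Ico 0 t₁, x ∈ Ico 0 T := fun x hx => ⟨hx.1, hx.2.trans_le ht₁⟩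
  have hvv : ∀ x ∈ Ico 0 t₁, v x ^ 2 ≤ 2 * v x * (v x * (u x - w x) - v x + s x) / A := by
    intro x hx
    rw [le_div_iff₀ hA]
    have hx0 := (hvp x (Ico_subset_Icc_self (hI' x hx))).le
    have h1 := mul_nonneg (mul_nonneg hx0 hx0)
      (by linarith [hD x hx] : (0 : ℝ) ≤ u x - w x - 1 - A / 2)
    nlinarith [mul_nonneg hx0 (hs x (Ico_subset_Icc_self (hI' x hx)))]
  have hv2 : ∀ x ∈ Ico 0 t₁, HasDerivWithinAt (fun y => v y ^ 2 / A)
      (2 * v x * (v x * (u x - w x) - v x + s x) / A) (Ici x) x := fun x hx =>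
    (((hv' x (hI' x hx)).fun_pow 2).div_const A).congr_deriv (by norm_num)
  constructor
  · have hf' : ∀ x ∈ Ico 0 t₁, HasDerivWithinAt
        (fun y => u y - A * Real.exp (-y) + v y ^ 2 / A + P * y)
        (-u x - v x ^ 2 + p x - A * (Real.exp (-x) * -1) +
          2 * v x * (v x * (u x - w x) - v x + s x) / A + P * 1) (Ici x) x := fun x hx =>
      (((hu' x (hI' x hx)).fun_sub
        (((hasDerivAt_neg' x).exp.const_mul A).hasDerivWithinAt)).fun_add (hv2 x hx)).fun_add
        (((hasDerivAt_id' x).const_mul P).hasDerivWithinAt)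
    have hfc : ContinuousOn (fun y => u y - A * Real.exp (-y) + v y ^ 2 / A + P * y)
        (Icc 0 t₁) := ContinuousOn.mono (by fun_prop) hI
    have h := exp_mul_le_of_le_deriv_right (β := -1) hfc hf'
      (fun x hx => by
        have := (abs_le.mp (hp x (Ico_subset_Icc_self (hI' x hx)))).1
        have := mul_nonneg hP hx.1
        have := div_nonneg (sq_nonneg (v x)) hA.le
        linarith [hvv x hx]) t ht
    simp only [hu0, neg_zero, Real.exp_zero, mul_one, mul_zero, add_zero, sub_self, zero_add,
      sub_zero, neg_mul, one_mul] at h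
    nlinarith [mul_nonneg (div_nonneg (sq_nonneg (v 0)) hA.le) (Real.exp_pos (-t)).le]
  · have hf' : ∀ x ∈ Ico 0 t₁, HasDerivWithinAt (fun y => 1 + v y ^ 2 / A + P * y - w y)
        (2 * v x * (v x * (u x - w x) - v x + s x) / A + P * 1 -
          (-ν * w x + v x ^ 2 + r x)) (Ici x) x := fun x hx =>
      (((hv2 x hx).const_add 1).fun_add
        (((hasDerivAt_id' x).const_mul P).hasDerivWithinAt)).fun_sub (hw' x (hI' x hx))
    have hfc : ContinuousOn (fun y => 1 + v y ^ 2 / A + P * y - w y) (Icc 0 t₁) :=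
      ContinuousOn.mono (by fun_prop) hI
    have h := exp_mul_le_of_le_deriv_right (β := -ν) hfc hf'
      (fun x hx => by
        have := (abs_le.mp (hr x (Ico_subset_Icc_self (hI' x hx)))).2
        have hν0 : (0 : ℝ) ≤ ν := by linarith
        have := mul_nonneg (mul_nonneg hν0 hP) hx.1
        have := mul_nonneg hν0 (div_nonneg (sq_nonneg (v x)) hA.le)
        nlinarith [hvv x hx]) t ht
    simp only [mul_zero, add_zero, sub_zero] at h
    have h0 : (0 : ℝ) ≤ 1 + v 0 ^ 2 / A - w 0 := by
      have := div_nonneg (sq_nonneg (v 0)) hA.le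
      linarith
    nlinarith [mul_nonneg h0 (Real.exp_pos (-ν * t)).le]

/-- The bootstrap. As long as the bond has stayed below `A/8` on `[0,t]`, the gate is still
rising: `u - w ≥ A/2 + 1` on `[0,t]` (continuity argument on the first exit time of the closed
condition `w - u ≤ -(A/2 + 1)`; at the exit time the brackets of `riseClock_lin`,
`riseClock_phase` give `u - w ≥ (4/7)A - A/32 - P - 1 > A/2 + 1`). [folklore] -/
theorem riseClock_boot {ν P T A t : ℝ} {u v w p r s : ℝ → ℝ} (hν : 1 ≤ ν) (hP : 0 ≤ P)
    (hT : T ≤ 1 / 2) (hA : 400 * (1 + P) ≤ A) (hu0 : u 0 = A) (hw0 : 0 ≤ w 0) (hw1 : w 0 ≤ 1)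
    (hv0 : 0 < v 0)
    (hu : ContinuousOn u (Icc 0 T)) (hv : ContinuousOn v (Icc 0 T))
    (hw : ContinuousOn w (Icc 0 T))
    (hu' : ∀ t ∈ Ico 0 T, HasDerivWithinAt u (-u t - v t ^ 2 + p t) (Ici t) t)
    (hv' : ∀ t ∈ Ico 0 T, HasDerivWithinAt v (v t * (u t - w t) - v t + s t) (Ici t) t)
    (hw' : ∀ t ∈ Ico 0 T, HasDerivWithinAt w (-ν * w t + v t ^ 2 + r t) (Ici t) t)
    (hp : ∀ t ∈ Icc 0 T, |p t| ≤ P) (hr : ∀ t ∈ Icc 0 T, |r t| ≤ P)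
    (hs : ∀ t ∈ Icc 0 T, 0 ≤ s t) (ht : t ∈ Icc 0 T) (hsm : ∀ t' ∈ Icc 0 t, v t' ≤ A / 8) :
    ∀ τ ∈ Icc 0 t, A / 2 + 1 ≤ u τ - w τ := by
  have hA0 : 0 < A := by linarith
  have hlin := riseClock_lin hν hP hu0 hw0 hv0 hu hv hw hu' hv' hw' hp hr hs
  have hg : ContinuousOn (fun x => w x - u x) (Icc 0 t) :=
    (hw.sub hu).mono (Icc_subset_Icc_right ht.2)
  have hg0 : w 0 - u 0 ≤ -(A / 2 + 1) := by rw [hu0]; linarith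
  have hmem : maximalTimeP (fun x => w x - u x ≤ -(A / 2 + 1)) 0 t ∈ Icc 0 t :=
    maximalTimeP_le_const_mem (g := fun x => w x - u x) ht.1 hg0
  have hspec : ∀ τ ∈ Icc 0 (maximalTimeP (fun x => w x - u x ≤ -(A / 2 + 1)) 0 t),
      w τ - u τ ≤ -(A / 2 + 1) := fun τ hτ => maximalTimeP_le_const_spec ht.1 hg hg0 hτ
  have hexit : maximalTimeP (fun x => w x - u x ≤ -(A / 2 + 1)) 0 t < t →
      w (maximalTimeP (fun x => w x - u x ≤ -(A / 2 + 1)) 0 t) -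
        u (maximalTimeP (fun x => w x - u x ≤ -(A / 2 + 1)) 0 t) = -(A / 2 + 1) :=
    fun hlt => eq_of_maximalTimeP_le_const_lt ht.1 hg hg0 hlt
  generalize maximalTimeP (fun x => w x - u x ≤ -(A / 2 + 1)) 0 t = ts at hmem hspec hexit
  rcases eq_or_lt_of_le hmem.2 with heq | hlt
  · subst heq
    intro τ hτ
    linarith [hspec τ hτ]
  · exfalso
    have htsT : ts ≤ T := hmem.2.trans ht.2
    have hph := riseClock_phase hν hP hA0 htsT hu0 hw1 hu hv hw hu' hv' hw' hp hr hs
      (fun x hx => (hlin x hx).1)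
      (fun x hx => by linarith [hspec x (Ico_subset_Icc_self hx)]) ts ⟨hmem.1, le_rfl⟩
    have hl := hlin ts ⟨hmem.1, htsT⟩
    have he := mul_le_mul_of_nonneg_left (riseClock_exp_ge hmem.1 (htsT.trans hT)) hA0.le
    have hsq : v ts ^ 2 ≤ (A / 8) ^ 2 := pow_le_pow_left₀ hl.1.le (hsm ts hmem) 2
    have h1 : v ts ^ 2 / A ≤ A / 64 := by rw [div_le_iff₀ hA0]; nlinarith [hsq]
    have h3 : P * ts ≤ P * (1 / 2) := mul_le_mul_of_nonneg_left (htsT.trans hT) hP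
    linarith [hph.1, hph.2, hexit hlt]

/-- The clock on a rise interval `[0,t]` (`u - w ≥ A/2 + 1` throughout, carrier brackets
available). Lower bound: `log v - A(1 - e^{-τ}) + 2τ + Pτ² + 2v²/A²` is non-decreasing
(`(log v)' ≥ D - 1 ≥ Ae^{-τ} - 2v²/A - 2Pτ - 2` and `(2v²/A²)' ≥ 2v²/A`). Upper bound (variation
of constants): `v e^{-Φ} + (2Ps/A) e^{-Aτ/2}` is non-increasing, `Φ(τ) = A(1 - e^{-τ}) - τ + Pτ²`
(`v' ≤ Φ' v + Ps`, `Φ(τ) ≥ Aτ/2`). [folklore] -/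
theorem riseClock_clock {P Ps T A t : ℝ} {u v w s : ℝ → ℝ} (hP : 0 ≤ P) (hPs : 0 ≤ Ps)
    (hA4 : 4 ≤ A) (hT : T ≤ 1 / 2) (ht : t ∈ Icc 0 T) (hv : ContinuousOn v (Icc 0 T))
    (hv' : ∀ t ∈ Ico 0 T, HasDerivWithinAt v (v t * (u t - w t) - v t + s t) (Ici t) t)
    (hs : ∀ t ∈ Icc 0 T, 0 ≤ s t ∧ s t ≤ Ps) (hvp : ∀ t ∈ Icc 0 T, 0 < v t)
    (hD : ∀ τ ∈ Ico 0 t, A / 2 + 1 ≤ u τ - w τ)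
    (hlo : ∀ τ ∈ Ico 0 t, A * Real.exp (-τ) - 2 * v τ ^ 2 / A - 2 * P * τ - 1 ≤ u τ - w τ)
    (hup : ∀ τ ∈ Ico 0 t, u τ - w τ ≤ A * Real.exp (-τ) + 2 * P * τ) :
    A * (1 - Real.exp (-t)) - 2 * t - P * t ^ 2 - 2 * v t ^ 2 / A ^ 2 ≤
        Real.log (v t) - Real.log (v 0) ∧
      v t * Real.exp (-(A * (1 - Real.exp (-t)) - t + P * t ^ 2)) ≤ v 0 + 2 * Ps / A := by
  have hA : 0 < A := by linarith
  have hI : Icc 0 t ⊆ Icc 0 T := Icc_subset_Icc_right ht.2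
  have hI' : ∀ x ∈ Ico 0 t, x ∈ Ico 0 T := fun x hx => ⟨hx.1, hx.2.trans_le ht.2⟩
  have hvI : ContinuousOn v (Icc 0 t) := hv.mono hI
  have htt : t ∈ Icc 0 t := ⟨ht.1, le_rfl⟩
  constructor
  · have hG' : ∀ x ∈ Ico 0 t, HasDerivWithinAt (fun y => Real.log (v y) -
          A * (1 - Real.exp (-y)) + 2 * y + P * y ^ 2 + 2 * v y ^ 2 / A ^ 2)
        ((v x * (u x - w x) - v x + s x) / v x - A * Real.exp (-x) + 2 + 2 * P * x +
          4 * v x * (v x * (u x - w x) - v x + s x) / A ^ 2) (Ici x) x := by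
      intro x hx
      have hvx := hvp x (Ico_subset_Icc_self (hI' x hx))
      refine ((((((hv' x (hI' x hx)).log hvx.ne').fun_sub
        ((((hasDerivAt_neg' x).exp.const_sub 1).const_mul A).hasDerivWithinAt)).fun_add
        (((hasDerivAt_id' x).const_mul 2).hasDerivWithinAt)).fun_add
        (((hasDerivAt_pow 2 x).const_mul P).hasDerivWithinAt)).fun_add
        ((((hv' x (hI' x hx)).fun_pow 2).const_mul 2).div_const (A ^ 2))).congr_deriv ?_
      norm_num
      ring
    have hGc : ContinuousOn (fun y => Real.log (v y) -
        A * (1 - Real.exp (-y)) + 2 * y + P * y ^ 2 + 2 * v y ^ 2 / A ^ 2) (Icc 0 t) :=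
      ((((hvI.log fun x hx => (hvp x (hI hx)).ne').sub (by fun_prop)).add (by fun_prop)).add
        (by fun_prop)).add ((continuousOn_const.mul (hvI.pow 2)).div_const _)
    have h := le_of_deriv_right_nonneg hGc hG' (fun x hx => by
      have hvx := hvp x (Ico_subset_Icc_self (hI' x hx))
      have hs0 := (hs x (Ico_subset_Icc_self (hI' x hx))).1
      have h1 : u x - w x - 1 ≤ (v x * (u x - w x) - v x + s x) / v x := by
        rw [le_div_iff₀ hvx]; nlinarith
      have hAv : A * v x ^ 2 ≤ 2 * v x * (v x * (u x - w x) - v x + s x) := by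
        have := mul_nonneg (mul_nonneg hvx.le hvx.le)
          (by linarith [hD x hx] : (0 : ℝ) ≤ u x - w x - 1 - A / 2)
        nlinarith [mul_nonneg hvx.le hs0]
      have h2 : 2 * v x ^ 2 / A ≤ 4 * v x * (v x * (u x - w x) - v x + s x) / A ^ 2 := by
        rw [div_le_div_iff₀ hA (by positivity)]
        nlinarith [mul_le_mul_of_nonneg_left hAv (by positivity : (0 : ℝ) ≤ 2 * A)]
      linarith [hlo x hx]) t htt
    simp only [neg_zero, Real.exp_zero, sub_self, mul_zero, add_zero, sub_zero, ne_eq,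
      OfNat.ofNat_ne_zero, not_false_eq_true, zero_pow] at h
    have : 0 ≤ 2 * v 0 ^ 2 / A ^ 2 := by positivity
    linarith
  · have hA' : A ≠ 0 := hA.ne'
    have hck : 2 * Ps / A * (A / 2) = Ps := by field_simp
    have hW' : ∀ x ∈ Ico 0 t, HasDerivWithinAt
        (fun y => v y * Real.exp (-(A * (1 - Real.exp (-y)) - y + P * y ^ 2)) +
          2 * Ps / A * Real.exp (-(A / 2) * y))
        (Real.exp (-(A * (1 - Real.exp (-x)) - x + P * x ^ 2)) *
            (v x * (u x - w x) - v x + s x - (A * Real.exp (-x) - 1 + 2 * P * x) * v x) -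
          2 * Ps / A * (A / 2) * Real.exp (-(A / 2) * x)) (Ici x) x := by
      intro x hx
      refine (((hv' x (hI' x hx)).fun_mul
        ((((((hasDerivAt_neg' x).exp.const_sub 1).const_mul A).fun_sub
          (hasDerivAt_id' x)).fun_add ((hasDerivAt_pow 2 x).const_mul P)).fun_neg.exp
          |>.hasDerivWithinAt)).fun_add
        ((((hasDerivAt_id' x).const_mul (-(A / 2))).exp.const_mul
          (2 * Ps / A)).hasDerivWithinAt)).congr_deriv ?_
      norm_num
      ring
    have hWc : ContinuousOn (fun y => v y * Real.exp (-(A * (1 - Real.exp (-y)) - y + P * y ^ 2)) +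
        2 * Ps / A * Real.exp (-(A / 2) * y)) (Icc 0 t) :=
      (hvI.mul (by fun_prop)).add (by fun_prop)
    have h := le_of_deriv_right_nonpos hWc hW' (fun x hx => by
      rw [hck]
      have hvx := (hvp x (Ico_subset_Icc_self (hI' x hx))).le
      have hsx := (hs x (Ico_subset_Icc_self (hI' x hx))).2
      have hX : v x * (u x - w x) - v x + s x - (A * Real.exp (-x) - 1 + 2 * P * x) * v x
          ≤ Ps := by
        nlinarith [mul_le_mul_of_nonneg_left (hup x hx) hvx]
      have hE : Real.exp (-(A * (1 - Real.exp (-x)) - x + P * x ^ 2)) ≤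
          Real.exp (-(A / 2) * x) := by
        apply Real.exp_le_exp.mpr
        have h1 := mul_le_mul_of_nonneg_left (riseClock_exp_le hx.1) hA.le
        have h2 := mul_le_mul_of_nonneg_left (show x ≤ 1 / 2 by linarith [hx.2, ht.2])
          (mul_nonneg hx.1 hA.le)
        have h3 := mul_nonneg hx.1 (by linarith : (0 : ℝ) ≤ A / 4 - 1)
        nlinarith [mul_nonneg hP (sq_nonneg x)]
      nlinarith [mul_le_mul_of_nonneg_left hX (Real.exp_pos
        (-(A * (1 - Real.exp (-x)) - x + P * x ^ 2))).le,
        mul_le_mul_of_nonneg_left hE hPs, Real.exp_pos (-(A / 2) * x)]) t htt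
    simp only [neg_zero, Real.exp_zero, sub_self, mul_zero, add_zero, mul_one,
      ne_eq, OfNat.ofNat_ne_zero, not_false_eq_true, zero_pow] at h
    have : 0 ≤ 2 * Ps / A * Real.exp (-(A / 2) * t) := by positivity
    linarith

/-- **RISE (CLOCK) LEMMA.** In the setting of `toda_gate_sigma`, with the seed bounded separately by `Ps`
(`0 ≤ s ≤ Ps ≤ P`): as long as the bond has stayed below `A/8` on `[0,t]`, the old carrier follows its free decay
`A e^{−t}` up to the (geometrically small) transferred energy `v(t)²/A` and `P t`, the new carrier has only received
that much, and THE CLOCK READS `log(v(t)/v(0)) = A(1 − e^{−t}) − t ± O(1)`: the bond's accumulated growth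
exponent is `∫(D − 1)`, `D = u − w = A e^{−s} − O(v²/A) − O(1)`, and `∫₀ᵗ v²/A ≤ v(t)²/A²` because `v` grows at
rate `≥ 0.55 A`. -/
theorem toda_rise_clock :
    ∀ (ν P Ps T A : ℝ) (u v w p r s : ℝ → ℝ),
    1 ≤ ν → ν ≤ 2 → 0 ≤ P → 0 ≤ Ps → Ps ≤ P → 0 < T → T ≤ 1 / 2 → 400 * (1 + P) ≤ A →
    u 0 = A → 0 ≤ w 0 → w 0 ≤ 1 → 0 < v 0 → v 0 ≤ 1 →
    ContinuousOn u (Set.Icc 0 T) → ContinuousOn v (Set.Icc 0 T) → ContinuousOn w (Set.Icc 0 T) →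
    (∀ t ∈ Set.Ico 0 T, HasDerivWithinAt u (-u t - v t ^ 2 + p t) (Set.Ici t) t) →
    (∀ t ∈ Set.Ico 0 T, HasDerivWithinAt v (v t * (u t - w t) - v t + s t) (Set.Ici t) t) →
    (∀ t ∈ Set.Ico 0 T, HasDerivWithinAt w (-ν * w t + v t ^ 2 + r t) (Set.Ici t) t) →
    (∀ t ∈ Set.Icc 0 T, |p t| ≤ P) → (∀ t ∈ Set.Icc 0 T, |r t| ≤ P) →
    (∀ t ∈ Set.Icc 0 T, 0 ≤ s t ∧ s t ≤ Ps) →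
    ∀ t ∈ Set.Icc 0 T, (∀ t' ∈ Set.Icc 0 t, v t' ≤ A / 8) →
      0 < v t ∧
      A * Real.exp (-t) - v t ^ 2 / A - P * t ≤ u t ∧ u t ≤ A * Real.exp (-t) + P * t ∧
      -(P * t) ≤ w t ∧ w t ≤ 1 + v t ^ 2 / A + P * t ∧
      A * (1 - Real.exp (-t)) - 2 * t - P * t ^ 2 - 1 / 30 ≤ Real.log (v t / v 0) ∧
      Real.log (v t / v 0) ≤ A * (1 - Real.exp (-t)) - t + P * t ^ 2 + Real.log (1 + 2 * Ps / (A * v 0)) := by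
  intro ν P Ps T A u v w p r s hν _ hP hPs _ _ hT2 hA hu0 hw0 hw1 hv0 _ hu hv hw hu' hv' hw' hp
    hr hs t ht hsm
  have hA0 : 0 < A := by linarith
  have hs0 : ∀ τ ∈ Icc 0 T, 0 ≤ s τ := fun τ hτ => (hs τ hτ).1
  have hlin := riseClock_lin hν hP hu0 hw0 hv0 hu hv hw hu' hv' hw' hp hr hs0
  have hD := riseClock_boot hν hP hT2 hA hu0 hw0 hw1 hv0 hu hv hw hu' hv' hw' hp hr hs0 ht hsm
  have hph := riseClock_phase hν hP hA0 ht.2 hu0 hw1 hu hv hw hu' hv' hw' hp hr hs0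
    (fun x hx => (hlin x hx).1) (fun x hx => hD x (Ico_subset_Icc_self hx))
  have hclock := riseClock_clock hP hPs (by linarith) hT2 ht hv hv' hs
    (fun x hx => (hlin x hx).1) (fun x hx => hD x (Ico_subset_Icc_self hx))
    (fun x hx => by
      have h1 := hph x (Ico_subset_Icc_self hx)
      have e : 2 * v x ^ 2 / A = 2 * (v x ^ 2 / A) := by ring
      linarith [h1.1, h1.2])
    (fun x hx => by
      have h1 := hlin x ⟨hx.1, hx.2.le.trans ht.2⟩
      linarith [h1.2.1, h1.2.2])
  have hlt := hlin t ht
  have hpt := hph t ⟨ht.1, le_rfl⟩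
  have hvt := hlt.1
  have hlog : Real.log (v t / v 0) = Real.log (v t) - Real.log (v 0) :=
    Real.log_div hvt.ne' hv0.ne'
  refine ⟨hvt, hpt.1, hlt.2.1, hlt.2.2, hpt.2, ?_, ?_⟩
  · have hsq : v t ^ 2 ≤ (A / 8) ^ 2 := pow_le_pow_left₀ hvt.le (hsm t ⟨ht.1, le_rfl⟩) 2
    have h32 : 2 * v t ^ 2 / A ^ 2 ≤ 1 / 32 := by
      rw [div_le_iff₀ (by positivity)]; nlinarith [hsq]
    rw [hlog]
    linarith [hclock.1]
  · rw [Real.log_le_iff_le_exp (div_pos hvt hv0), Real.exp_add, Real.exp_log (by positivity),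
      div_le_iff₀ hv0]
    have h1 : Real.exp (A * (1 - Real.exp (-t)) - t + P * t ^ 2) *
        Real.exp (-(A * (1 - Real.exp (-t)) - t + P * t ^ 2)) = 1 := by
      rw [← Real.exp_add, add_neg_cancel, Real.exp_zero]
    have h2 := mul_le_mul_of_nonneg_left hclock.2
      (Real.exp_pos (A * (1 - Real.exp (-t)) - t + P * t ^ 2)).le
    have h3 : Real.exp (A * (1 - Real.exp (-t)) - t + P * t ^ 2) * (1 + 2 * Ps / (A * v 0)) * v 0 =
        Real.exp (A * (1 - Real.exp (-t)) - t + P * t ^ 2) * (v 0 + 2 * Ps / A) := by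
      field_simp
    rw [h3]
    calc v t = Real.exp (A * (1 - Real.exp (-t)) - t + P * t ^ 2) *
          Real.exp (-(A * (1 - Real.exp (-t)) - t + P * t ^ 2)) * v t := by rw [h1, one_mul]
      _ = Real.exp (A * (1 - Real.exp (-t)) - t + P * t ^ 2) *
          (v t * Real.exp (-(A * (1 - Real.exp (-t)) - t + P * t ^ 2))) := by ring
      _ ≤ _ := h2

end Summit.NavierStokesRegularity.NavierStokesRegularity.Theorems.PerpetualPumpCircuitPump
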